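import Summits.FinalStateConjecture.FinalStateConjecture.Statement

/-! Census §Strengthen, S⁺2 typed: "parking is locally a C¹ wall of non-zero gradient in every tame censored 2-parameter family"
(AKU Thm 2 shape). Recorded as a signature only (not filed): it is false on the trapped stratum (fold) and presupposes label rigidity. -/

set_option linter.dupNamespace false
noncomputable section
open scoped Manifold ContDiff Topology
open Literature.Geometry.Lorentzian
open Summit.FinalStateConjecture (HasCompleteNullInfinity exteriorOf RaysStayInClosure HasExhaustiveCharts IsFutureOriented)

namespace Summit.FinalStateConjecture.FinalStateConjecture.Cruxes.CaptureSufficesTame.StrategistS1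

section
variable {X : Type} [TopologicalSpace X] [ChartedSpace E3 X] [IsManifold (𝓡 3) ∞ X] [T2Space X]
  [SecondCountableTopology X] [ConnectedSpace X]

/-- CENSORED (as in Lines/only_the_third_law_is_generic.lean §1). -/
def Censored (D : InitialDataSet (𝓡 3) X) : Prop :=
  (∃ 𝒟 : VacuumCauchyDevelopment D, 𝒟.IsMaximal) ∧
    ∀ 𝒟 : VacuumCauchyDevelopment D, 𝒟.IsMaximal → HasCompleteNullInfinity 𝒟.toCauchyDevelopment

/-- UN-PARKED, ∃-form (as in Lines/only_the_third_law_is_generic.lean §1). -/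
def Unparked (D : InitialDataSet (𝓡 3) X) : Prop :=
  ∀ 𝒟 : VacuumCauchyDevelopment D, 𝒟.IsMaximal →
    HasCompleteNullInfinity 𝒟.toCauchyDevelopment ∧
      ((∃ (O : Set 𝒟.carrier) (d₀ : FinalStateDecomposition 𝒟.toSpacetime O 0),
          O = exteriorOf 𝒟.toCauchyDevelopment d₀.charted ∧ RaysStayInClosure 𝒟.toCauchyDevelopment O ∧
            HasExhaustiveCharts d₀ ∧ IsFutureOriented d₀) →
        ∃ (O : Set 𝒟.carrier) (d : FinalStateDecomposition 𝒟.toSpacetime O 0),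
          (∀ i, Kerr.IsSubextremal (d.mass i) (d.spin i)) ∧
            O = exteriorOf 𝒟.toCauchyDevelopment d.charted ∧ RaysStayInClosure 𝒟.toCauchyDevelopment O ∧
              HasExhaustiveCharts d ∧ IsFutureOriented d)

end

/-- S⁺2 (strengthen-to-IFT form of the residue R). -/
def UnparkingWall : Prop :=
  ∀ (X : Type) [TopologicalSpace X] [ChartedSpace E3 X] [IsManifold (𝓡 3) ∞ X] [T2Space X]
    [SecondCountableTopology X] [ConnectedSpace X],
    ∀ (e : AFEnd X) (H : EuclideanSpace ℝ (Fin 2) → InitialDataSet (𝓡 3) X),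
      InitialDataSet.IsTameDataFamily e 2 H → (∀ p, H p ∈ admissibleVacuumData X) → (∀ p, Censored (H p)) →
        ¬ Unparked (H 0) →
          ∃ σ : EuclideanSpace ℝ (Fin 2) → ℝ, ContDiff ℝ 1 σ ∧ fderiv ℝ σ 0 ≠ 0 ∧
            ∀ᶠ p in 𝓝 (0 : EuclideanSpace ℝ (Fin 2)), (¬ Unparked (H p) ↔ σ p = 0)

end Summit.FinalStateConjecture.FinalStateConjecture.Cruxes.CaptureSufficesTame.StrategistS1

end
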